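import Summits.CriticalPhenomena.PercolationContinuityZ3.Theorems.PercNearOneGluingNoHeavyLowerTailSunflowerFlipPurePayer
import Summits.CriticalPhenomena.PercolationContinuityZ3.Theorems.PercNearOneGluingNoHeavyLowerTailSunflowerPurePayerRefutation
import HarnessLib

/-!
# `NoHeavyLowerTail` (crux stmt-CriticalPhenomena-4575), abstract sunflower cubic: the typed dichotomy `FlipPurePayer` is FALSE
# (it contains `PurePayer`, refuted by the cyclic star `CS(3,3,3)`; `not_purePayer`), and what SURVIVES of `…SunflowerFlipPurePayer`

Support file (seat `prim-ineq-gen-2` gen 29; `--supports stmt-CriticalPhenomena-4575`).  No `sorry`, no new definitions.  CORRECTION OF RECORD for the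
companion file `…SunflowerFlipPurePayer` (same seat, same day): its `@[conjecture] FlipPurePayer` ("on every mixed fibre the larger flipped spectator
surplus alone pays the flipped rainbows", `Ntriflip D ≤ 3·max(SAflip D, SBflip D)`) specialises at `D = ∅` to prim-ineq-prove-1's `PurePayer`
(`purePayer_of_flipPurePayer`), and `PurePayer` is REFUTED in the tree by the nine-point cyclic star `CS(3,3,3)` (`not_purePayer`,
`…SunflowerPurePayerRefutation`: `3·SA − Ntri = −6`, `3·SB − Ntri = −324`, `ZH = 972`).  Hence `not_flipPurePayer` below.  The census quoted in that
file (0 failures among ≈ 8.6·10⁶ fibres of random structures on ≤ 8 points) is correct as a census but does not reach the nine-point witness; the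
dichotomy is therefore a SMALL-STRUCTURE phenomenon at the fibre level.  What survives, unconditionally: the flipped spectator form
`ZHflip D = 3(SAflip D + SBflip D) − Ntriflip D` with `SAflip D, SBflip D ≥ 0` (`Swflip_nonneg`, the fibrewise Gladkov halves; prim-l12-p2's
`MSunflower.SwKflip_nonneg` is the `k`-petal version), and the PER-FIBRE criterion `flipPurePayerAt` below, which implies `ZHflip D ≥ 0` on every
fibre where it holds (all fibres on ≤ 8 points tested).  At the LAW level the corresponding dichotomies — prim-ineq-prove-1's (C1-law)
`max(LA, LB) ≥ 0` and the one-coordinate `LawPencil` polarized form — are NOT refuted by the cyclic star: (C1-law) is a theorem on the whole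
cyclic-star law family (prove-1, `…CyclicStar…`, INEQ-CLAIMS l.1758) and the polarized form has 0 failures on `CS(3,3,3)` in 300 random
parameter vectors × 9 coordinates (memo SHARP-FORM-GEN29 §7); a positive mixture of fibres can satisfy a dichotomy that single fibres violate.

* `not_flipPurePayer : ¬ FlipPurePayer`.
* `ZHflip_nonneg_of_flipPurePayerAt` — the per-fibre criterion `Ntriflip D ≤ 3·max(SAflip D, SBflip D)` at one `(F, D)` gives `0 ≤ ZHflip D` there.
* `exists_not_flipPurePayerAt` — the criterion fails somewhere (at `CS(3,3,3)`, `D = ∅`).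
-/

namespace Summit.CriticalPhenomena.PercolationContinuityZ3.Theorems.SunflowerPartition

open Finset

/-- **`FlipPurePayer` is false**: it implies `PurePayer` (`D = ∅`), which the cyclic star `CS(3,3,3)` violates (`not_purePayer`). [this work] -/
theorem not_flipPurePayer : ¬ FlipPurePayer :=
  fun h => not_purePayer (purePayer_of_flipPurePayer h)

/-- **Per-fibre pure-payer criterion ⟹ Conjecture G on that fibre**: if at one `(F, D)` the larger flipped spectator surplus pays the
flipped rainbows, `Ntriflip D ≤ 3·max(SAflip D, SBflip D)`, then `0 ≤ ZHflip D` (both surpluses are nonnegative, `SAflip_nonneg`, `SBflip_nonneg`).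
[this work] -/
theorem ZHflip_nonneg_of_flipPurePayerAt {α : Type*} [Fintype α] [DecidableEq α] (F : Sunflower α) (D : Finset α)
    (h : F.Ntriflip D ≤ 3 * max (F.SAflip D) (F.SBflip D)) : 0 ≤ F.ZHflip D := by
  have hA := F.SAflip_nonneg D
  have hB := F.SBflip_nonneg D
  rw [F.ZHflip_eq_SAflip_SBflip D]
  rcases le_total (F.SAflip D) (F.SBflip D) with hle | hle
  · rw [max_eq_right hle] at h
    linarith
  · rw [max_eq_left hle] at h
    linarith

/-- **The per-fibre criterion is not universal**: some finite three-petal sunflower and flip set violate it (the cyclic star at `D = ∅`).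
[this work] -/
theorem exists_not_flipPurePayerAt :
    ∃ (α : Type) (_ : Fintype α) (_ : DecidableEq α) (F : Sunflower α) (D : Finset α),
      ¬ F.Ntriflip D ≤ 3 * max (F.SAflip D) (F.SBflip D) := by
  by_contra h
  exact not_flipPurePayer fun α _ _ F D => by
    by_contra h'
    exact h ⟨α, inferInstance, inferInstance, F, D, h'⟩

end Summit.CriticalPhenomena.PercolationContinuityZ3.Theorems.SunflowerPartition
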